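import Summits.ResolutionOfSingularities.ResolutionOfSingularities.Theorems.PurelyInseparableDim4ChartAtlasSNCGoodNearFarPackage
import Summits.ResolutionOfSingularities.ResolutionOfSingularities.Theorems.PurelyInseparableDim4ChartAtlasSNCManyHeights
import Literature.AlgebraicGeometry.Resolution.BlowupSequencesExtendOpen
import HarnessLib

/-!
# Purely inseparable four-folds `z^p + F(x₁, …, x₄)`: THE FAR-RESONANCE REPAIR CENTRE ON `W` — the disjoint union of the resonance loci
# `Zc ∩ {x_j = h}` is a closed, regular centre inside the `x_j`-chart, inside `supp M′`, snc with the transformed near/far boundary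
# (cell `res-dim4-pi`, typ-2 g7; HANDOFF OPEN 4 «transport of the far repair to the walk's stage objects», W-level, escaping case `j ∉ S'`)

[OURS · counted 0] (D-0157 DOOR 2; DR-157-C.) Setting of the S3-N1 atlas / the far positive p704073: `π : W → 𝔸⁵` ANY blowing up along
`V(z, x_S)`, the walk's point `b` on the `x_j`-chart (`j ∈ S`, `b_j = 0`), re-centring `Θⱼ` of record (`z^p + F ↦ x_j^p (z^p + F₁)`), next centre
variables `S' ∌ j`, global centre `Zc = 𝓘(closure φⱼ V(z, x_{S'}))`, old boundary `E = [(xᵢ + cᵢ)·𝒪 : i ∈ ms] ++ [(xᵢ + dᵢ)·𝒪 : i ∈ fs]` (near: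
`c = 0` on `S`; far: `i ∈ S`, `dᵢ ≠ 0`), `M′ = ((z^p + F)·𝒪, E, p).transform π 𝓘Λ_S`. When active far members RESONATE (p704073's `hH1`/`hH2`
fail) at the non-zero heights `hs` (`x_j = h` on `Zc`), the repair of p718376 / `…FarRepairHeights` blows up, on the chart model, the centre
`C(hs) = Π_{h ∈ hs} ψ_{−h}^*𝓘(V(y_0, y_{S'}, y_j))`. PROVED here (no `sorry`, no new axiom): its EXTENSION TO `W`,
`C_W = 𝓘(closure φⱼ(V(C(hs))))` (Literature `BlowupSequencesExtendOpen`), is a legitimate centre of the walk: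

* `mem_opensRange_chartImm_of_X_not_mem` — a point of `W` over `{x_m ≠ 0}` (`m` a centre variable) lies in the `x_m`-chart (p688180's
  overlap lemma `chartImm_apply_mem_opensRange_of_not_mem` + the chart cover);
* `exists_mem_of_list_prod_mem` — a prime containing a product of a list contains a member;
* **`farRepairCentre_package`** — `φⱼ^*C_W = C(hs)`, `V(C_W) ⊆ φⱼ(𝔸⁵)` (the resonance loci lie over `{x_j = h}`, `h ≠ 0`, hence in the
  `x_j`-chart), `V(C_W) ⊆ V(Zc) ⊆ supp M′`, `V(C_W)` REGULAR, and `HasSNCWith M′.boundary C_W` (the transformed boundary read on the chart is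
  the natural-frame alphabet — hyperplanes and far quadrics `((yᵢ + bᵢ)·y_j + dᵢ)`, p699206 §3 — snc with `C(hs)` by p718376
  `hasSNCWith_prod_heights` at `c′ = 0`; extended by Literature `HasSNC.hasSNCWith_vanishingIdeal_closureImage`).

With `…SNCLocalBaseOffCentre` (p719344) and `…SNCManyHeights` this yields the far repair ON `W` (companion file `…SNCFarRepairW`). Nothing here
is a statement about resolution of singularities in dimension ≥ 4 / characteristic `p` (NOT proved anywhere in this programme). bears_on:
LADDER-RESOLUTION:D157-DOOR2 (res-dim4-pi). Supports stmt-ResolutionOfSingularities-16155 (helper).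
-/

-- every declaration of this summit lives under `Summit.ResolutionOfSingularities.ResolutionOfSingularities`
-- (summit = problem), which the duplicate-namespace linter flags; house convention (cf. the Target file).
set_option linter.dupNamespace false

noncomputable section

open MvPolynomial CategoryTheory AlgebraicGeometry Opposite TopologicalSpace
open AlgebraicGeometry.Scheme.IdealSheafData (ofIdealTop vanishingIdeal)

namespace Summit.ResolutionOfSingularities.ResolutionOfSingularities.Theorems.PIDim4

open Literature.AlgebraicGeometry.Resolution
open Literature.AlgebraicGeometry.Resolution.Hauser2010
open Literature.AlgebraicGeometry.Resolution.AffinePointBlowup (P A γ coord Wtop ξ)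
open Literature.Barriers.ResolutionOfSingularities

namespace ChartDictionary

/-! ## §1 Two small tools -/

section Tools

variable {K : Type} [Field K] {Λ : Set (Fin (4 + 1))} {W : Scheme.{0}} {π : W ⟶ P 4 K}

/-- **A point of `W` over `{x_m ≠ 0}`, `m` a centre variable, lies in the `x_m`-chart** (for ANY blowing up of `𝔸⁵` along `V(x_Λ)`): it lies
in some chart `xᵢ` (p688180's cover), where `π^*x_m = xᵢ·x_m` does not vanish, so the overlap lemma `chartImm_apply_mem_opensRange_of_not_mem`
applies. -/
theorem mem_opensRange_chartImm_of_X_not_mem (hπ : IsBlowup π (AffineCoordBlowup.𝓘Λ 4 K Λ)) {m : Fin (4 + 1)} (hm : m ∈ Λ) {w : W}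
    (hw : (X m : A 4 K) ∉ (π w).asIdeal) : w ∈ (AffineCoordBlowup.chartImm hπ hm).opensRange := by
  obtain ⟨⟨i, hi⟩, y, rfl⟩ := AffineCoordBlowup.exists_mem_opensRange_chartImm hπ w
  by_cases him : m = i
  · subst him
    exact ⟨y, rfl⟩
  · refine chartImm_apply_mem_opensRange_of_not_mem hπ hi hm him fun hXm => hw ?_
    rw [← Scheme.Hom.comp_apply, AffineCoordBlowup.chartImm_comp hπ hi, Spec.map_apply, PrimeSpectrum.comap_asIdeal, Ideal.mem_comap,
      CommRingCat.hom_ofHom, AlgHom.toRingHom_eq_coe, AlgHom.coe_toRingHom, coordBlowupSubst_X_of_mem_of_ne K Λ i hm him]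
    exact y.asIdeal.mul_mem_left _ hXm

/-- A prime ideal containing the product of a list contains one of its members. -/
theorem exists_mem_of_list_prod_mem {R : Type*} [CommRing R] {I : Ideal R} (hI : I.IsPrime) :
    ∀ l : List R, l.prod ∈ I → ∃ a ∈ l, a ∈ I
  | [], h => absurd (I.eq_top_iff_one.mpr (by simpa using h)) hI.ne_top
  | a :: l, h => by
    rw [List.prod_cons] at h
    rcases hI.mem_or_mem h with ha | hl
    · exact ⟨a, List.mem_cons.mpr (Or.inl rfl), ha⟩
    · obtain ⟨a', ha', ha'I⟩ := exists_mem_of_list_prod_mem hI l hl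
      exact ⟨a', List.mem_cons.mpr (Or.inr ha'), ha'I⟩

end Tools

/-! ## §2 The repair centre on `W` -/

section Centre

variable {K : Type} [Field K] {p : ℕ} [hp : Fact p.Prime] [CharP K p]
  {S S' : Finset (Fin 4)} {j : Fin 4} {b : Fin 4 → K} {Θⱼ : A 4 K ≃ₐ[K] A 4 K} {h : MvPolynomial (Fin 4) K}
  {F F₁ : MvPolynomial (Fin 4) K} {W : Scheme.{0}} {π : W ⟶ P 4 K}

/-- **THE FAR-RESONANCE REPAIR CENTRE ON `W`** (escaping case `j ∉ S'`; heights `hs ≠ []` pairwise distinct and non-zero). With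
`C(hs) = Π_{h ∈ hs} ψ_{−h}^*𝓘(V(y_0, y_{S'}, y_j))` on the `x_j`-chart and `C_W = 𝓘(closure φⱼ(V(C(hs))))`: `φⱼ^*C_W = C(hs)`, `V(C_W) ⊆ φⱼ(𝔸⁵)`,
`V(C_W) ⊆ V(Zc)`, `V(C_W) ⊆ supp M′`, `V(C_W)` is REGULAR, and `HasSNCWith M′.boundary C_W` for the near/far boundary (near `c = 0` on `S`; far
`i ∈ S`, `dᵢ ≠ 0`, `i ∉ ms`) — `C_W` is an admissible centre for `M′`. -/
theorem farRepairCentre_package [IsAlgClosed K] (hj : j ∈ S) (hjS' : j ∉ S') (hbj : b j = 0)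
    (h0j : Θⱼ (X 0) = X 0 + rename Fin.succ h) (hsj : ∀ i : Fin 4, Θⱼ (X i.succ) = X i.succ + C (b i))
    (hπ : IsBlowup π (AffineCoordBlowup.𝓘Λ 4 K (insert 0 (Fin.succ '' (S : Set (Fin 4))))))
    (hperm : (p : ℕ∞) ≤ CentreBlowup.ordAlong S F)
    (hread : Θⱼ (coordBlowupSubst K (insert 0 (Fin.succ '' (S : Set (Fin 4)))) j.succ (hyp p F)) = X j.succ ^ p * hyp p F₁)
    (hperm' : (p : ℕ∞) ≤ CentreBlowup.ordAlong S' F₁) (ms fs : List (Fin 4)) (c d : Fin 4 → K) (hc : ∀ i ∈ S, c i = 0)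
    (hfs : ∀ i ∈ fs, i ∈ S ∧ d i ≠ 0) (hdis : ∀ i ∈ fs, i ∉ ms)
    (hs : List K) (hne : hs ≠ []) (hnd : hs.Nodup) (h0 : ∀ h' ∈ hs, h' ≠ 0) :
    haveI : IsIso (CommRingCat.ofHom (Θⱼ : A 4 K →+* A 4 K)) := (inferInstance : IsIso Θⱼ.toRingEquiv.toCommRingCatIso.hom)
    let φⱼ := Spec.map (CommRingCat.ofHom (Θⱼ : A 4 K →+* A 4 K)) ≫ AffineCoordBlowup.chartImm hπ (succ_mem_centreVars hj)
    let Zc := vanishingIdeal (closureImage φⱼ ((AffineCoordBlowup.𝓘Λ 4 K (insert 0 (Fin.succ '' (S' : Set (Fin 4))))).support : Set (P 4 K)))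
    let M' := ((⟨hypSheaf p F, (ms.map fun i => ofIdealTop (Ideal.span {(γ 4 K).symm (X i.succ + C (c i))})) ++
        fs.map fun i => ofIdealTop (Ideal.span {(γ 4 K).symm (X i.succ + C (d i))}), p⟩ :
        MarkedIdeal (P 4 K)).transform π (AffineCoordBlowup.𝓘Λ 4 K (insert 0 (Fin.succ '' (S : Set (Fin 4))))))
    let Cmod := (hs.map fun h' => (AffineCoordBlowup.𝓘Λ 4 K (insert 0 (Fin.succ '' ((insert j S' : Finset (Fin 4)) : Set (Fin 4))))).comap
      (Spec.map (CommRingCat.ofHom ((AffinePointBlowup.translateEquiv (n := 4) (Pi.single j.succ (-h')) : A 4 K ≃ₐ[K] A 4 K) :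
        A 4 K →+* A 4 K)))).prod
    let CW := vanishingIdeal (closureImage φⱼ (Cmod.support : Set (P 4 K)))
    CW.comap φⱼ = Cmod ∧ (CW.support : Set W) ⊆ Set.range φⱼ ∧ (CW.support : Set W) ⊆ Zc.support ∧
      (CW.support : Set W) ⊆ M'.support ∧ Scheme.IsRegular CW.subscheme ∧ HasSNCWith M'.boundary CW := by
  intro φⱼ Zc M' Cmod CW
  classical
  haveI hisoj : IsIso (CommRingCat.ofHom (Θⱼ : A 4 K →+* A 4 K)) := (inferInstance : IsIso Θⱼ.toRingEquiv.toCommRingCatIso.hom)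
  haveI : IsOpenImmersion φⱼ := inferInstanceAs (IsOpenImmersion
    (Spec.map (CommRingCat.ofHom (Θⱼ : A 4 K →+* A 4 K)) ≫ AffineCoordBlowup.chartImm hπ (succ_mem_centreVars hj)))
  haveI : IsProper π := hπ.isProper
  haveI : IsLocallyNoetherian W := LocallyOfFiniteType.isLocallyNoetherian π
  set Λ : Set (Fin (4 + 1)) := insert 0 (Fin.succ '' (S : Set (Fin 4))) with hΛ
  set E : List (Scheme.IdealSheafData (P 4 K)) :=
    (ms.map fun i => ofIdealTop (Ideal.span {(γ 4 K).symm (X i.succ + C (c i))})) ++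
      fs.map fun i => ofIdealTop (Ideal.span {(γ 4 K).symm (X i.succ + C (d i))}) with hEdef
  -- the model centre is regular, hence radical
  have hCreg : Scheme.IsRegular Cmod.subscheme := isRegular_subscheme_prod_heights (K := K) (T := S') (j := j) hs hnd
  haveI : IsReduced Cmod.subscheme := hCreg.isReduced
  have hCrad : Cmod.radical = Cmod := radical_eq_of_isReduced_subscheme Cmod
  -- the chart map in coordinates
  have hφπ : ∀ (y : P 4 K) (q : A 4 K),
      q ∈ (π (φⱼ y)).asIdeal ↔ Θⱼ (coordBlowupSubst K Λ j.succ q) ∈ y.asIdeal := by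
    intro y q
    rw [← Scheme.Hom.comp_apply, show φⱼ ≫ π = Spec.map (CommRingCat.ofHom (Θⱼ : A 4 K →+* A 4 K)) ≫
        Spec.map (CommRingCat.ofHom (coordBlowupSubst K Λ j.succ).toRingHom) by
      rw [Category.assoc, AffineCoordBlowup.chartImm_comp hπ (succ_mem_centreVars hj)],
      ← Spec.map_comp, ← CommRingCat.ofHom_comp, Spec.map_apply, PrimeSpectrum.comap_asIdeal, Ideal.mem_comap, CommRingCat.hom_ofHom,
      RingHom.comp_apply, AlgHom.toRingHom_eq_coe, AlgHom.coe_toRingHom, RingHom.coe_coe]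
  -- the closed set `T = V(Zc) ∩ π⁻¹ V(Π (x_j − h))` contains `φⱼ(V(Cmod))` and lies in the `x_j`-chart
  set T : Set W := (Zc.support : Set W) ∩ π.base ⁻¹' {x : P 4 K | (hs.map fun h' => (X j.succ - C h' : A 4 K)).prod ∈ x.asIdeal} with hT
  have hTclosed : IsClosed T := by
    refine Zc.support.isClosed.inter (IsClosed.preimage π.continuous ?_)
    have e1 : {x : P 4 K | (hs.map fun h' => (X j.succ - C h' : A 4 K)).prod ∈ x.asIdeal} =
        ((ofIdealTop (Ideal.span {(γ 4 K).symm (hs.map fun h' => (X j.succ - C h' : A 4 K)).prod})).support : Set (P 4 K)) := by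
      ext x
      rw [Set.mem_setOf_eq, SetLike.mem_coe, mem_support_ofIdealTop_span_γ_symm_iff]
    rw [e1]
    exact (ofIdealTop _).support.isClosed
  have hTj : T ⊆ Set.range φⱼ := by
    rintro w ⟨-, hw⟩
    obtain ⟨q, hq, hqw⟩ := exists_mem_of_list_prod_mem (π w).2 _ hw
    obtain ⟨h', hh', rfl⟩ := List.mem_map.mp hq
    have hX : (X j.succ : A 4 K) ∉ (π w).asIdeal := fun hX => by
      have h1 := (π w).asIdeal.sub_mem hX hqw
      rw [sub_sub_cancel, C_mem_asIdeal_iff] at h1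
      exact h0 h' hh' h1
    have hmem := mem_opensRange_chartImm_of_X_not_mem hπ (succ_mem_centreVars hj) hX
    change w ∈ Set.range φⱼ
    rw [range_specMap_comp_chartImm]
    exact hmem
  have hCT : (Cmod.support : Set (P 4 K)) ⊆ φⱼ ⁻¹' T := by
    intro y hy
    obtain ⟨h', hh', hy'⟩ := (mem_support_prod_heights_iff hs y).mp hy
    rw [mem_support_comap_spec_translate_𝓘Λ_iff] at hy'
    have hyS' : ∀ i ∈ (insert 0 (Fin.succ '' (S' : Set (Fin 4))) : Set (Fin (4 + 1))), (X i : A 4 K) ∈ y.asIdeal := by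
      intro i hi
      have hij : i ≠ j.succ := fun e => hjS' ((succ_mem_centreVars_iff S' j).mp (e ▸ hi))
      have h1 := hy' i (centreVars_subset_centreVars_insert S' j hi)
      rwa [Pi.single_eq_of_ne hij, C_0, add_zero] at h1
    have hyj : (X j.succ + C (-h') : A 4 K) ∈ y.asIdeal := by
      have h1 := hy' j.succ (succ_mem_centreVars (Finset.mem_insert_self j S'))
      rwa [Pi.single_eq_same] at h1
    refine ⟨?_, ?_⟩
    · -- `φⱼ y ∈ V(Zc)`
      show φⱼ y ∈ Zc.support
      have h1 : y ∈ (Zc.comap φⱼ).support := by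
        rw [show Zc.comap φⱼ = AffineCoordBlowup.𝓘Λ 4 K (insert 0 (Fin.succ '' (S' : Set (Fin 4)))) from comap_globalCentre _ _,
          AffineCoordBlowup.support_𝓘Λ, AffineCoordBlowup.mem_CΛ_iff']
        exact hyS'
      exact (mem_support_comap_iff _ _ y).mp h1
    · -- `π (φⱼ y) ∈ V(Π (x_j − h))`
      show (hs.map fun h' => (X j.succ - C h' : A 4 K)).prod ∈ (π (φⱼ y)).asIdeal
      obtain ⟨r, hr⟩ := List.dvd_prod (List.mem_map.mpr ⟨h', hh', rfl⟩ :
        (X j.succ - C h' : A 4 K) ∈ hs.map fun h' => (X j.succ - C h' : A 4 K))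
      rw [hr, hφπ, map_mul, map_mul]
      refine y.asIdeal.mul_mem_right _ ?_
      rw [map_sub, coordBlowupSubst_X_self, coordBlowupSubst_C, map_sub, hsj j, hbj, C_0, add_zero,
        show Θⱼ (C h') = C h' from Θⱼ.commutes h', sub_eq_add_neg, ← map_neg C]
      exact hyj
  -- the package
  have hCsub : (CW.support : Set W) ⊆ T := support_vanishingIdeal_closureImage_subset φⱼ hTclosed hCT
  have hZsupp : (Zc.support : Set W) ⊆ M'.support :=
    support_globalCentre_subset_support_transform hj hbj h0j hsj hπ hperm hread hperm'
  refine ⟨comap_vanishingIdeal_closureImage_support φⱼ hCrad, hCsub.trans hTj, fun w hw => (hCsub hw).1,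
    fun w hw => hZsupp (hCsub hw).1, isRegular_subscheme_vanishingIdeal_closureImage φⱼ hCreg hTclosed hTj hCT, ?_⟩
  -- snc: the transformed boundary is snc on `W`, and its chart readings are snc with `C(hs)`
  have hE : HasSNCWith E (AffineCoordBlowup.𝓘Λ 4 K Λ) := hasSNCWith_nearFar_𝓘Λ (K := K) (S := S) ms fs c d hdis j
  have hsncW : HasSNC M'.boundary := by
    show HasSNC (((⟨hypSheaf p F, E, p⟩ : MarkedIdeal (P 4 K)).transform π (AffineCoordBlowup.𝓘Λ 4 K Λ)).boundary)
    rw [MarkedIdeal.transform_boundary]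
    exact hE.hasSNC_transform hπ
  refine HasSNC.hasSNCWith_vanishingIdeal_closureImage φⱼ hsncW hCrad ?_ hTclosed hTj hCT
  -- the readings on the `x_j`-chart: hyperplanes `H` and far quadrics `(i, dᵢ)`, `i ∈ fs ∖ j`
  let H : Finset (Fin (4 + 1) × K) :=
    insert (j.succ, (0 : K)) (ms.toFinset.image (fun i => (i.succ, b i + c i)) ∪ (if j ∈ fs then {(j.succ, d j)} else ∅))
  have hHmem : ∀ ka, ka ∈ H ↔ ka = (j.succ, (0 : K)) ∨ (∃ i ∈ ms, ka = (i.succ, b i + c i)) ∨ (j ∈ fs ∧ ka = (j.succ, d j)) := by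
    intro ka
    simp only [H, Finset.mem_insert, Finset.mem_union, Finset.mem_image, List.mem_toFinset]
    refine or_congr Iff.rfl (or_congr ⟨fun ⟨i, hi, e⟩ => ⟨i, hi, e.symm⟩, fun ⟨i, hi, e⟩ => ⟨i, hi, e.symm⟩⟩ ?_)
    by_cases hjfs : j ∈ fs
    · rw [if_pos hjfs, Finset.mem_singleton]; exact ⟨fun h => ⟨hjfs, h⟩, fun h => h.2⟩
    · rw [if_neg hjfs]; exact ⟨fun h => absurd h (Finset.notMem_empty _), fun h => absurd h.1 hjfs⟩
  show HasSNCWith (M'.boundary.map (·.comap φⱼ)) Cmod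
  rw [show M'.boundary = E.map (strictTransformIdeal π (AffineCoordBlowup.𝓘Λ 4 K Λ)) ++ [(AffineCoordBlowup.𝓘Λ 4 K Λ).comap π] from
    MarkedIdeal.transform_boundary _ _ _]
  refine hasSNCWith_prod_heights (K := K) (T := S') (j := j) (b := b) (e := d) (c' := 0) hjS' hs hne hnd
    (fun h' hh' => by rw [zero_sub, neg_ne_zero]; exact h0 h' hh') H (fs.toFinset.erase j) (Finset.notMem_erase j _)
    (fun i hi => by rw [mul_zero, add_zero]; exact (hfs i (List.mem_toFinset.mp (Finset.mem_of_mem_erase hi))).2) ?_ ?_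
  · -- (C1) a hyperplane of a quadric's index is the near member of that index
    intro i hi a ha
    rcases (hHmem _).mp ha with e | ⟨i', hi', e⟩ | ⟨-, e⟩
    · exact absurd (Fin.succ_injective _ (Prod.mk.inj e).1) (Finset.ne_of_mem_erase hi)
    · obtain ⟨e1, e2⟩ := Prod.mk.inj e
      have hii' : i = i' := Fin.succ_injective _ e1
      subst hii'
      rw [e2, hc i (hfs i (List.mem_toFinset.mp (Finset.mem_of_mem_erase hi))).1, add_zero]
    · exact absurd (Fin.succ_injective _ (Prod.mk.inj e).1) (Finset.ne_of_mem_erase hi)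
  · -- the members, read on the chart
    intro D hD
    rw [List.map_append, List.map_map, List.mem_append, List.mem_map, List.map_singleton, List.mem_singleton] at hD
    rcases hD with ⟨D₀, hD₀, rfl⟩ | rfl
    · rcases List.mem_append.mp hD₀ with hD₀ | hD₀
      · -- near members
        obtain ⟨i, hi, rfl⟩ := List.mem_map.mp hD₀
        simp only [Function.comp_apply]
        by_cases hij : i = j
        · subst hij
          left
          rw [hc i hj, C_0, add_zero, Scheme.IdealSheafData.comap_comp,
            show (γ 4 K).symm (X i.succ) = coord 4 K i.succ from rfl, strictTransformIdeal_hyperplane_self_comap_chartImm hj hπ,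
            Scheme.IdealSheafData.comap_top]
        · right; left
          refine ⟨(i.succ, b i + c i), (hHmem _).mpr (Or.inr (Or.inl ⟨i, hi, rfl⟩)), ?_⟩
          rw [Scheme.IdealSheafData.comap_comp]
          by_cases hiS : i ∈ S
          · rw [hc i hiS, C_0, add_zero, add_zero, show (γ 4 K).symm (X i.succ) = coord 4 K i.succ from rfl,
              strictTransformIdeal_hyperplane_comap_chartImm hj hij hπ,
              show coord 4 K i.succ = (γ 4 K).symm (X i.succ) from rfl, comap_ofIdealTop_span_γ_symm, RingHom.coe_coe, hsj i]
          · have hC : Θⱼ (C (c i)) = C (c i) := Θⱼ.commutes (c i)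
            rw [strictTransformIdeal_translate_comap_chartImm hj hiS (c i) hπ, comap_ofIdealTop_span_γ_symm, RingHom.coe_coe,
              map_add, hsj i, hC, add_assoc, ← C_add]
      · -- far members
        obtain ⟨i, hi, rfl⟩ := List.mem_map.mp hD₀
        obtain ⟨hiS, hdi⟩ := hfs i hi
        simp only [Function.comp_apply]
        by_cases hij : i = j
        · subst hij
          right; left
          refine ⟨(i.succ, d i), (hHmem _).mpr (Or.inr (Or.inr ⟨hi, rfl⟩)), ?_⟩
          rw [comap_recenter_chart_strictTransform_far_self hj hdi hsj hπ, hbj, zero_add]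
        · right; right
          refine ⟨i, Finset.mem_erase.mpr ⟨hij, List.mem_toFinset.mpr hi⟩, ?_⟩
          rw [comap_recenter_chart_strictTransform_far hj hiS hij hdi hsj hπ, hbj, C_0, add_zero, zero_mul, sub_zero]
    · -- the exceptional component
      right; left
      refine ⟨(j.succ, 0), (hHmem _).mpr (Or.inl rfl), ?_⟩
      rw [Scheme.IdealSheafData.comap_comp, comap_𝓘Λ_chartImm hj hπ, show coord 4 K j.succ = (γ 4 K).symm (X j.succ) from rfl,
        comap_ofIdealTop_span_γ_symm, RingHom.coe_coe, hsj j, hbj]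

end Centre

end ChartDictionary

end Summit.ResolutionOfSingularities.ResolutionOfSingularities.Theorems.PIDim4

end
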